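import Literature.Probability.Percolation.PercolationSharpThreshold
import Literature.Probability.Moments.BiasedCubeLevelOne
import HarnessLib

/-!
# The Level-1 (Talagrand) bound for increasing events of bond percolation: `Σ_e I_e²` and `dP_p(A)/dp`

Topic `Literature/Probability/Percolation`. Transfer of the biased-cube Level-1 inequality
(`BiasedCube.sum_sq_piv_le`, `BiasedCube.sum_piv_le_sqrt`, file
`Literature/Probability/Moments/BiasedCubeLevelOne.lean`: O'Donnell 2014 §5.3 / Talagrand 1996, sharp
constant via the entropic proof of Impagliazzo–Moore–Russell) to Bernoulli bond percolation `P_p` on a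
graph `G`, along the encoding of `PercolationSharpThreshold.lean` (`cfg`, `ind`, `Ep_indicator_eq_real`,
`Ep_piv_ind_eq_real`). For `0 < p < 1`, a finite `F ⊆ E(G)` and an increasing event `A` determined by
`F`, with `t = P_p(A)` and `I_e = P_p(e is pivotal for A)`:

* `levelOne_event` — **`Σ_{e∈F} I_e² ≤ t² log(1/t) / (2p²(1−p)²)`** (vs. the Bessel / Moore–Shannon
  bound `Σ I_e² ≤ t(1−t)/(p(1−p))` of `MooreShannonInfluenceBound.lean`);
* `sum_pivotal_le_event` — **`Σ_{e∈F} I_e ≤ t·√(|F|·log(1/t)/2)/(p(1−p))`**;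
* `deriv_real_event_le` — with Russo's formula (`SharpThreshold.hasDerivAt_real_event`):
  **`dP_p(A)/dp ≤ P_p(A)·√(|F|·log(1/P_p(A))/2)/(p(1−p))`** — the "Russo–Talagrand" form of the
  Chayes–Chayes–Fisher–Spencer / Moore–Shannon derivative bound `√(|F|·P(1−P)/(p(1−p)))`
  (Grimmett 1999 Thm (2.36)(a)), better exactly for RARE events (`t log(1/t) ≲ p(1−p)(1−t)`).

Everything is proved; no named facts, no definitions.

## References

* R. O'Donnell, *Analysis of Boolean Functions*, CUP 2014, §5.3 "Level-1 Inequality" [ODonnell2014].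
* M. Talagrand, Combinatorica 16 (1996) 243–258 [Talagrand1996].
* L. Russo, Z. Wahrsch. verw. Gebiete 56 (1981), §4 Lemma 3 (Russo's formula) [RussoZW1981].
* G. Grimmett, *Percolation*, 2nd ed. 1999, Thm (2.36)(a) (the square-root bound being improved)
  [GrimmettPercolation1999].
-/

noncomputable section

namespace Literature.Probability.Percolation

namespace LevelOne

open _root_.MeasureTheory Finset Literature.Probability.Moments Literature.Probability.Moments.BiasedCube
  SharpThreshold
open scoped Classical

variable {V : Type*} {G : SimpleGraph V} {F : Finset (Sym2 V)}

/-- Sums over `F` of a function of the pivotality probabilities are sums over the cube coordinates.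
[cite: RussoZW1981, §4 Lemma 3 (proof)] -/
private theorem sum_real_pivotal_eq (hF : (↑F : Set (Sym2 V)) ⊆ G.edgeSet) {A : Set (BondConfig V)}
    (hA : IsUpperSet A) (hAF : DeterminedBy A (↑F : Set (Sym2 V))) (p : unitInterval) (φ : ℝ → ℝ) :
    ∑ e ∈ F, φ ((bondPercolation G p).real {ω | IsPivotal A e ω}) =
      ∑ i : Fin F.card, φ (Ep (p : ℝ) (piv i (ind F A))) := by
  rw [← Finset.sum_coe_sort F, ← Fintype.sum_equiv (enc F) (fun i => φ (Ep (p : ℝ) (piv i (ind F A))))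
    (fun e => φ ((bondPercolation G p).real {ω | IsPivotal A (e : Sym2 V) ω}))
    (fun i => by rw [Ep_piv_ind_eq_real hF hA hAF p i])]

/-- **Level-1 inequality for increasing events of bond percolation**: for `0 < p < 1`, a finite
`F ⊆ E(G)` and an increasing event `A` determined by `F`, with `t = P_p(A)`,
`Σ_{e∈F} P_p(e pivotal for A)² ≤ t² log(1/t) / (2p²(1−p)²)`.
[cite: ODonnell2014, §5.3 "Level-1 Inequality"] [cite: Talagrand1996, §1 (level-1 weight of increasing sets)] -/
theorem levelOne_event (hF : (↑F : Set (Sym2 V)) ⊆ G.edgeSet) {A : Set (BondConfig V)} (hA : IsUpperSet A)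
    (hAF : DeterminedBy A (↑F : Set (Sym2 V))) (p : unitInterval) (hp0 : 0 < (p : ℝ)) (hp1 : (p : ℝ) < 1) :
    ∑ e ∈ F, (bondPercolation G p).real {ω | IsPivotal A e ω} ^ 2 ≤
      (bondPercolation G p).real A ^ 2 * (-Real.log ((bondPercolation G p).real A)) /
        (2 * ((p : ℝ) * (1 - p)) ^ 2) := by
  rw [← Ep_indicator_eq_real hF hAF p, sum_real_pivotal_eq hF hA hAF p (fun r => r ^ 2)]
  exact sum_sq_piv_le hp0 hp1 (ind_eq_zero_or_one A)

/-- **Sum of pivotality probabilities of an increasing event** (Level-1 + Cauchy–Schwarz): with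
`t = P_p(A)`, `Σ_{e∈F} P_p(e pivotal for A) ≤ t·√(|F|·log(1/t)/2)/(p(1−p))`.
[cite: ODonnell2014, §5.3 "Level-1 Inequality"] -/
theorem sum_pivotal_le_event (hF : (↑F : Set (Sym2 V)) ⊆ G.edgeSet) {A : Set (BondConfig V)} (hA : IsUpperSet A)
    (hAF : DeterminedBy A (↑F : Set (Sym2 V))) (p : unitInterval) (hp0 : 0 < (p : ℝ)) (hp1 : (p : ℝ) < 1) :
    ∑ e ∈ F, (bondPercolation G p).real {ω | IsPivotal A e ω} ≤
      (bondPercolation G p).real A *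
          Real.sqrt (F.card * (-Real.log ((bondPercolation G p).real A)) / 2) / ((p : ℝ) * (1 - p)) := by
  have h := sum_real_pivotal_eq hF hA hAF p id
  simp only [id] at h
  rw [← Ep_indicator_eq_real hF hAF p, h]
  exact sum_piv_le_sqrt hp0 hp1 (ind_eq_zero_or_one A)

/-- **The Russo–Talagrand derivative bound**: for `p ∈ (0,1)`, a finite `F ⊆ E(G)` and an increasing
event `A` determined by `F`, `p ↦ P_p(A)` (real parameter, through `Set.projIcc 0 1`) has derivative
`≤ P_p(A)·√(|F|·log(1/P_p(A))/2)/(p(1−p))` — Russo's formula `dP_p(A)/dp = Σ_e P_p(e pivotal)` and the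
Level-1 bound; compare `dP_p(A)/dp ≤ √(|F|·P_p(A)(1−P_p(A))/(p(1−p)))` (Grimmett 1999 Thm (2.36)(a),
`MooreShannonInfluenceBound.lean`). [cite: RussoZW1981, §4 Lemma 3 (4.2)] [cite: ODonnell2014, §5.3 "Level-1 Inequality"] -/
theorem deriv_real_event_le (hF : (↑F : Set (Sym2 V)) ⊆ G.edgeSet) {A : Set (BondConfig V)} (hA : IsUpperSet A)
    (hAF : DeterminedBy A (↑F : Set (Sym2 V))) {p : ℝ} (hp : p ∈ Set.Ioo (0 : ℝ) 1) :
    deriv (fun q : ℝ => (bondPercolation G (Set.projIcc 0 1 zero_le_one q)).real A) p ≤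
      (bondPercolation G (Set.projIcc 0 1 zero_le_one p)).real A *
          Real.sqrt (F.card * (-Real.log ((bondPercolation G (Set.projIcc 0 1 zero_le_one p)).real A)) / 2) /
        (p * (1 - p)) := by
  rw [(hasDerivAt_real_event hF hA hAF hp).deriv]
  have hcoe : ((Set.projIcc (0 : ℝ) 1 zero_le_one p : unitInterval) : ℝ) = p := by
    rw [Set.projIcc_of_mem zero_le_one ⟨hp.1.le, hp.2.le⟩]
  have h := sum_pivotal_le_event hF hA hAF (Set.projIcc 0 1 zero_le_one p) (by rw [hcoe]; exact hp.1)
    (by rw [hcoe]; exact hp.2)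
  rw [hcoe] at h
  exact h

end LevelOne

end Literature.Probability.Percolation

end
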